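import Mathlib
import Summits.AtomisticToContinuum.HydrodynamicLimit.Theorems.ImplosionDichotomyDenseExcursionPackingAnalyticDerivRecovery
import Summits.AtomisticToContinuum.HydrodynamicLimit.Theorems.ImplosionDichotomyDenseExcursionPackingAnalyticSonicDampedTransport

/-!
# The unweighted `w`-component at the centre from the weighted gain: the inner `C⁰` bound
# (crux `DenseExcursion`, stmt-AtomisticToContinuum-12586, line `sonic-cavity-renewal` v8, stub `stub_analyticPackingImplosion`)

Helper file (`--supports stmt-AtomisticToContinuum-12586`, line lead a2, wave-4 worker D1, task (0): the closure of the
majorant scheme under the weaker linear input `PackingResolventW`). THE DECISIVE STEP OF THE TWO-SCALE BOOKKEEPING. Under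
`PackingResolventW` the solution `u = (u₁, u₂)` of `(Λ − L)u = f`, `Λ = kμ`, gains `1/k` only in the weighted size
`|u₁|/(1 + S) + |u₂|/S ≤ a` (`a = C·N/k`); the sources of the next order need the UNWEIGHTED `|u₁| = |w_k|` with NO loss
(a bound `|u₁| ≤ C·(unweighted source norm)` — the Option-B conjunct of `PackingResolventW` — would lose a factor `k`,
because the unweighted `w`-source at the acoustic scale is genuinely `≍ k·(geometric)`: `Src_w ∋ 3S²(s₁/S)(s_{k−1}/S)′`,
`S²(s_j/S)′ ≍ Λ_j w_j/3` there). Kernel-checked here: the unweighted bound FOLLOWS from the weighted gain and the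
equations alone,

* `centre_w_bound` (REGISTERED helper): for a monatomic cavity-tube profile there is ONE constant `C` such that for every
  real `Λ ≥ 0`, every globally bounded differentiable real solution with `|u₁|/(1+S) + |u₂|/S ≤ a`, `|f₁| ≤ N₁`,
  `|f₂|/S ≤ N₂` satisfies `|u₁| ≤ C((Λ + 1)a + N₂ + N₁/(Λ + 1))` EVERYWHERE — with `a = C′N/k` this is `O(N)` with the
  `w`-source entering only as `N₁/k` (the `1/k` gain of the `w`-response to `w`-sources).
  Mechanism: eliminating `u₂′` from the two equations gives the damped transport
  `u₁′ = −γ u₁ + h`, `γ = [3S(S′ + 2S) + (W − 1)(Λ − W′ − 2W + r)]/(S² − (W−1)²)`,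
  `h = [3S(Λu₂ − f₂ − (W′/3 + 2W − r)u₂) + (W − 1)(f₁ + (3S′ + 6S)u₂)]/(S² − (W−1)²)`;
  on the half-line `x ≤ x_* := −½ log((400/49)(Λ + r + 2))` the tube envelope (c) (`|W| ≤ 1/4`, `|W′| ≤ 1/2`,
  `7/10 ≤ eˣS ≤ 1`, `|(eˣS)′| ≤ 1/4`, whence `|S′ + S| ≤ (5/14)S` and `S² ≥ 4(Λ + r + 2)`) gives `γ ≥ 1` (damping `3` from
  `3S(S′ + 2S) ≥ (27/14)S²`, anti-damping `(W−1)Λ/Δ = O(Λ/S²) ≤ 5/16`) and `|h| ≤ (6r + 16)((Λ+1)a + N₂ + N₁/(Λ+1))`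
  (`Λ|u₂| ≤ ΛaS`, `|f₁|/S² ≤ N₁/(4(Λ+1))`), so the max principle from `−∞` (`dampedTransport_apriori_bound` + the global
  bound) yields `|u₁| ≤ |h|_∞`; on `x ≥ x_*`, `|u₁| ≤ (1 + S)a` with `S ≤ e^{−x_*} ≤ (1 + e^{−2x_*})/2 = O(Λ + 1)` on
  `x ≤ 1` and `S` bounded on `x ≥ 1`;
* `centre_pointwise`: the pointwise algebra (positivity of `S² − (W−1)²`, the identity, `γ ≥ 1`, `|h| ≤ …`).

Worker numerics (`work/stubs/numD1/sizes.py`, full pinned profile): `γ_min = 2.50–2.67` on `x ≤ x_*`, and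
`sup_{x ≤ x_*}|u₁| ≤ sup|h|/γ_min` with ratios `0.54–0.58` (inner-scale `s`-sources) and `0.78–0.86` (`w`-sources of
unweighted size `0.55Λ`, weighted size `1`: `sup|u₁| = 0.20–0.26`, `Λ`-independent). NOT here: norms, the window, `Γ`.
-/

noncomputable section

open Set Filter Topology

namespace Summit.AtomisticToContinuum.HydrodynamicLimit.Theorems.PackingAnalyticImplosion

open Summit.AtomisticToContinuum.HydrodynamicLimit.Theorems.R2OneModeTwoConditions
open Summit.AtomisticToContinuum.HydrodynamicLimit.Theorems.SonicCavityRenewal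

/-! ## The pointwise algebra deep in the core -/

set_option maxHeartbeats 800000 in -- one declaration: many small `nlinarith` steps of one pointwise estimate
/-- **THE DAMPED TRANSPORT FOR `u₁` DEEP IN THE CORE, POINTWISE**: at a point with `|W| ≤ 1/4`, `|W′| ≤ 1/2`,
`|S′ + S| ≤ (5/14)S`, `S² ≥ 4(Λ + r + 2)` (`Λ ≥ 0`, `r ≥ 1`), every solution of the two real resolvent equations with
`|u₂| ≤ aS`, `|f₁| ≤ N₁`, `|f₂| ≤ N₂S` satisfies: `D = S² − (W−1)² > 0`, `u₁′ = −γu₁ + h` with `γ ≥ 1` and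
`|h| ≤ (6r + 16)((Λ + 1)a + N₂ + N₁/(Λ + 1))`. [folklore] -/
theorem centre_pointwise (r W W' S S' Λ u₁ u₁' u₂ u₂' f₁ f₂ a N₁ N₂ : ℝ) (hr : 1 ≤ r) (hΛ : 0 ≤ Λ) (hS : 0 < S)
    (hW : |W| ≤ 1 / 4) (hW' : |W'| ≤ 1 / 2) (hSS : |S' + S| ≤ 5 / 14 * S) (hbig : 4 * (Λ + r + 2) ≤ S ^ 2)
    (h1 : Λ * u₁ - ((W - 1) * u₁' + 3 * S * u₂' + (W' + 2 * W - r) * u₁ + (3 * S' + 6 * S) * u₂) = f₁)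
    (h2 : Λ * u₂ - (S / 3 * u₁' + (W - 1) * u₂' + (S' + 2 * S) * u₁ + (W' / 3 + 2 * W - r) * u₂) = f₂)
    (hu₂ : |u₂| ≤ a * S) (hf₁ : |f₁| ≤ N₁) (hf₂ : |f₂| ≤ N₂ * S) (ha : 0 ≤ a) (hN₁ : 0 ≤ N₁) (hN₂ : 0 ≤ N₂) :
    0 < S ^ 2 - (W - 1) ^ 2 ∧
    1 ≤ (3 * S * (S' + 2 * S) + (W - 1) * (Λ - W' - 2 * W + r)) / (S ^ 2 - (W - 1) ^ 2) ∧
    u₁' = -((3 * S * (S' + 2 * S) + (W - 1) * (Λ - W' - 2 * W + r)) / (S ^ 2 - (W - 1) ^ 2)) * u₁ +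
      (3 * S * (Λ * u₂ - f₂ - (W' / 3 + 2 * W - r) * u₂) + (W - 1) * (f₁ + (3 * S' + 6 * S) * u₂)) /
        (S ^ 2 - (W - 1) ^ 2) ∧
    |(3 * S * (Λ * u₂ - f₂ - (W' / 3 + 2 * W - r) * u₂) + (W - 1) * (f₁ + (3 * S' + 6 * S) * u₂)) /
        (S ^ 2 - (W - 1) ^ 2)| ≤ (6 * r + 16) * ((Λ + 1) * a + N₂ + N₁ / (Λ + 1)) := by
  have hWb := abs_le.mp hW
  have hW'b := abs_le.mp hW'
  have hSSb := abs_le.mp hSS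
  -- the determinant `D = S² − (W−1)² ∈ [S²/2, S²]`
  obtain ⟨D, hD⟩ : ∃ D : ℝ, D = S ^ 2 - (W - 1) ^ 2 := ⟨_, rfl⟩
  have hS2 : 12 ≤ S ^ 2 := by nlinarith only [hbig, hΛ, hr]
  have hW1sq : (W - 1) ^ 2 ≤ 25 / 16 := by nlinarith only [hWb.1, hWb.2]
  have hDlo : S ^ 2 / 2 ≤ D := by rw [hD]; nlinarith only [hW1sq, hS2]
  have hDhi : D ≤ S ^ 2 := by rw [hD]; nlinarith only [sq_nonneg (W - 1)]
  have hDpos : 0 < D := by nlinarith only [hDlo, hS2]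
  rw [← hD]
  -- the damping numerator
  obtain ⟨y, hy⟩ : ∃ y : ℝ, y = Λ - W' - 2 * W + r := ⟨_, rfl⟩
  have hy0 : 0 ≤ y := by rw [hy]; linarith only [hΛ, hW'b.2, hWb.2, hr]
  have hy1 : y ≤ Λ + r + 1 := by rw [hy]; linarith only [hW'b.1, hWb.1]
  obtain ⟨nγ, hnγ⟩ : ∃ nγ : ℝ, nγ = 3 * S * (S' + 2 * S) + (W - 1) * (Λ - W' - 2 * W + r) := ⟨_, rfl⟩
  have hnγlo : D ≤ nγ := by
    rw [hnγ, ← hy, hD]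
    have h3S : -(15 / 14 * S ^ 2) ≤ 3 * S * (S' + S) := by nlinarith only [hSSb.1, hS]
    have hWy : -(5 / 4 * y) ≤ (W - 1) * y := by nlinarith only [hWb.1, hy0]
    nlinarith only [h3S, hWy, hy1, hbig, sq_nonneg (W - 1), hΛ, hr]
  refine ⟨hDpos, ?_, ?_, ?_⟩
  · rw [← hnγ, one_le_div hDpos]; exact hnγlo
  · -- the identity: `D u₁′ = −nγ u₁ + n_h` by eliminating `u₂′`
    have hid : D * u₁' = -(3 * S * (S' + 2 * S) + (W - 1) * (Λ - W' - 2 * W + r)) * u₁ +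
        (3 * S * (Λ * u₂ - f₂ - (W' / 3 + 2 * W - r) * u₂) + (W - 1) * (f₁ + (3 * S' + 6 * S) * u₂)) := by
      rw [hD]; linear_combination (W - 1) * h1 - 3 * S * h2
    field_simp
    linarith [hid]
  · -- the source of the transport
    rw [abs_div, abs_of_pos hDpos, div_le_iff₀ hDpos]
    have hΛ1 : 0 < Λ + 1 := by linarith
    -- sizes of the pieces
    have p1 : |3 * S * (Λ * u₂)| ≤ 3 * S ^ 2 * (Λ * a) := by
      rw [abs_mul (3 * S), abs_of_pos (by linarith : (0:ℝ) < 3 * S), abs_mul Λ u₂, abs_of_nonneg hΛ]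
      have : Λ * |u₂| ≤ Λ * (a * S) := mul_le_mul_of_nonneg_left hu₂ hΛ
      nlinarith only [this, hS]
    have p2 : |3 * S * f₂| ≤ 3 * S ^ 2 * N₂ := by
      rw [abs_mul (3 * S), abs_of_pos (by linarith : (0:ℝ) < 3 * S)]
      nlinarith only [hf₂, hS]
    have hcoef : |W' / 3 + 2 * W - r| ≤ r + 2 / 3 := by
      rw [abs_le]; constructor <;> linarith only [hW'b.1, hW'b.2, hWb.1, hWb.2, hr]
    have p3 : |3 * S * ((W' / 3 + 2 * W - r) * u₂)| ≤ 3 * S ^ 2 * ((r + 2 / 3) * a) := by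
      rw [abs_mul (3 * S), abs_of_pos (by linarith : (0:ℝ) < 3 * S), abs_mul (W' / 3 + 2 * W - r) u₂]
      have : |W' / 3 + 2 * W - r| * |u₂| ≤ (r + 2 / 3) * (a * S) :=
        mul_le_mul hcoef hu₂ (abs_nonneg _) (by linarith)
      nlinarith only [this, hS]
    have hW1 : |W - 1| ≤ 5 / 4 := by rw [abs_le]; constructor <;> linarith only [hWb.1, hWb.2]
    have p4 : |(W - 1) * f₁| ≤ 5 / 4 * N₁ := by
      rw [abs_mul (W - 1) f₁]; exact mul_le_mul hW1 hf₁ (abs_nonneg _) (by norm_num)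
    have h36 : |3 * S' + 6 * S| ≤ 57 / 14 * S := by
      rw [abs_le]; constructor <;> linarith only [hSSb.1, hSSb.2, hS]
    have p5 : |(W - 1) * ((3 * S' + 6 * S) * u₂)| ≤ 5 / 4 * (57 / 14 * S * (a * S)) := by
      rw [abs_mul (W - 1), abs_mul (3 * S' + 6 * S) u₂]
      exact mul_le_mul hW1 (mul_le_mul h36 hu₂ (abs_nonneg _) (by positivity)) (by positivity) (by norm_num)
    -- triangle inequality
    have htri : |3 * S * (Λ * u₂ - f₂ - (W' / 3 + 2 * W - r) * u₂) + (W - 1) * (f₁ + (3 * S' + 6 * S) * u₂)| ≤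
        3 * S ^ 2 * (Λ * a) + 3 * S ^ 2 * N₂ + 3 * S ^ 2 * ((r + 2 / 3) * a) + 5 / 4 * N₁ +
          5 / 4 * (57 / 14 * S * (a * S)) := by
      have e : 3 * S * (Λ * u₂ - f₂ - (W' / 3 + 2 * W - r) * u₂) + (W - 1) * (f₁ + (3 * S' + 6 * S) * u₂) =
          3 * S * (Λ * u₂) - 3 * S * f₂ - 3 * S * ((W' / 3 + 2 * W - r) * u₂) + (W - 1) * f₁ +
            (W - 1) * ((3 * S' + 6 * S) * u₂) := by ring
      rw [e]
      calc _ ≤ |3 * S * (Λ * u₂) - 3 * S * f₂ - 3 * S * ((W' / 3 + 2 * W - r) * u₂) + (W - 1) * f₁| +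
            |(W - 1) * ((3 * S' + 6 * S) * u₂)| := abs_add_le _ _
        _ ≤ |3 * S * (Λ * u₂) - 3 * S * f₂ - 3 * S * ((W' / 3 + 2 * W - r) * u₂)| + |(W - 1) * f₁| +
            |(W - 1) * ((3 * S' + 6 * S) * u₂)| := by gcongr; exact abs_add_le _ _
        _ ≤ |3 * S * (Λ * u₂) - 3 * S * f₂| + |3 * S * ((W' / 3 + 2 * W - r) * u₂)| + |(W - 1) * f₁| +
            |(W - 1) * ((3 * S' + 6 * S) * u₂)| := by gcongr; exact abs_sub _ _
        _ ≤ |3 * S * (Λ * u₂)| + |3 * S * f₂| + |3 * S * ((W' / 3 + 2 * W - r) * u₂)| + |(W - 1) * f₁| +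
            |(W - 1) * ((3 * S' + 6 * S) * u₂)| := by gcongr; exact abs_sub _ _
        _ ≤ _ := by linarith only [p1, p2, p3, p4, p5]
    refine htri.trans ?_
    -- compare with `(6r + 16)·Q·D`, using `S²/2 ≤ D` and `D ≥ 2(Λ+1)`
    have hD2 : 2 * (Λ + 1) ≤ D := by nlinarith only [hDlo, hbig, hr]
    have hN₁D : 5 / 4 * N₁ ≤ N₁ / (Λ + 1) * D := by
      have e : N₁ / (Λ + 1) * D = N₁ * (D / (Λ + 1)) := by ring
      rw [e]
      have h2 : 2 ≤ D / (Λ + 1) := by rw [le_div_iff₀ hΛ1]; linarith only [hD2]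
      nlinarith only [h2, hN₁]
    have hS2D : S ^ 2 ≤ 2 * D := by linarith only [hDlo]
    have hQa : 0 ≤ (Λ * a + N₂ + (r + 2 / 3) * a + 2 * a) := by positivity
    have hmain : 3 * S ^ 2 * (Λ * a) + 3 * S ^ 2 * N₂ + 3 * S ^ 2 * ((r + 2 / 3) * a) +
        5 / 4 * (57 / 14 * S * (a * S)) ≤ 6 * D * (Λ * a + N₂ + (r + 2 / 3) * a + 2 * a) := by
      nlinarith only [hS2D, hQa, ha, hN₂, hΛ, hr, sq_nonneg S]
    have hfin : 6 * D * (Λ * a + N₂ + (r + 2 / 3) * a + 2 * a) + N₁ / (Λ + 1) * D ≤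
        (6 * r + 16) * ((Λ + 1) * a + N₂ + N₁ / (Λ + 1)) * D := by
      have hN₁' : 0 ≤ N₁ / (Λ + 1) := by positivity
      have q1 : 0 ≤ D * (Λ * a) := by positivity
      have q2 : 0 ≤ D * N₂ := by positivity
      have q3 : 0 ≤ D * (N₁ / (Λ + 1)) := by positivity
      have q4 : 0 ≤ r * (D * (Λ * a)) := by positivity
      have q5 : 0 ≤ r * (D * N₂) := by positivity
      have q6 : 0 ≤ r * (D * (N₁ / (Λ + 1))) := by positivity
      linarith only [q1, q2, q3, q4, q5, q6]
    linarith only [hmain, hfin, hN₁D]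

/-! ## The inner `C⁰` bound -/

/-- **THE UNWEIGHTED `w`-COMPONENT FROM THE WEIGHTED GAIN** (registered helper `centre_w_bound` of
`stub_analyticPackingImplosion`): for a monatomic cavity-tube profile there is ONE constant `C` such that for every real
`Λ ≥ 0` every globally bounded differentiable real solution `(u₁, u₂)` of the two real resolvent equations `Λu − Lu = f`
with `|u₁|/(1 + S) + |u₂|/S ≤ a`, `|f₁| ≤ N₁`, `|f₂|/S ≤ N₂` everywhere satisfies
`|u₁| ≤ C((Λ + 1)a + N₂ + N₁/(Λ + 1))` everywhere. [folklore] -/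
theorem centre_w_bound : ∀ (r : ℝ) (W S : ℝ → ℝ), IsMonatomicProfile r W S → CavityTube r W S → ∃ C : ℝ, 0 < C ∧ ∀ (Λ a N₁ N₂ : ℝ) (u₁ u₂ f₁ f₂ : ℝ → ℝ), 0 ≤ Λ → Differentiable ℝ u₁ → (∀ x, Λ * u₁ x - ((W x - 1) * deriv u₁ x + 3 * S x * deriv u₂ x + (deriv W x + 2 * W x - r) * u₁ x + (3 * deriv S x + 6 * S x) * u₂ x) = f₁ x ∧ Λ * u₂ x - (S x / 3 * deriv u₁ x + (W x - 1) * deriv u₂ x + (deriv S x + 2 * S x) * u₁ x + (deriv W x / 3 + 2 * W x - r) * u₂ x) = f₂ x) → (∃ B : ℝ, ∀ x, |u₁ x| ≤ B) → (∀ x, |u₁ x| / (1 + S x) + |u₂ x| / S x ≤ a) → (∀ x, |f₁ x| ≤ N₁) → (∀ x, |f₂ x| / S x ≤ N₂) → ∀ x, |u₁ x| ≤ C * ((Λ + 1) * a + N₂ + N₁ / (Λ + 1)) := by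
  intro r W S hP hT
  obtain ⟨hr1, -, -, hSs, hSpos, -, -, -, hSlim⟩ := hP
  obtain ⟨-, -, -, -, -, -, -, hcW, hcS, -, -⟩ := hT
  have hr : 1 ≤ r := hr1.le
  have hSd : Differentiable ℝ S := hSs.differentiable (by simp)
  have hSc : Continuous S := hSs.continuous
  -- `S` is bounded on `x ≥ 1`
  obtain ⟨BS, hBS⟩ := bdd_Ici_of_tendsto hSc.continuousOn hSlim
  have hBS0 : 0 ≤ BS := (abs_nonneg _).trans (hBS 1 le_rfl)
  -- the tube envelope on `x ≤ 1` in the form used below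
  have henv : ∀ x, x ≤ 1 → |W x| ≤ 1 / 4 ∧ |deriv W x| ≤ 1 / 2 ∧ |deriv S x + S x| ≤ 5 / 14 * S x ∧
      7 / 10 * Real.exp (-x) ≤ S x ∧ S x ≤ Real.exp (-x) := by
    intro x hx
    obtain ⟨hW, hW', -⟩ := hcW x hx
    obtain ⟨hlo, hhi, hd, -⟩ := hcS x hx
    have hex : 0 < Real.exp x := Real.exp_pos x
    have hexinv : Real.exp (-x) = (Real.exp x)⁻¹ := Real.exp_neg x
    have hderiv : deriv (fun y => Real.exp y * S y) x = Real.exp x * (deriv S x + S x) := by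
      rw [deriv_fun_mul (Real.differentiable_exp x) (hSd x), Real.deriv_exp]; ring
    rw [hderiv, abs_mul, abs_of_pos hex] at hd
    refine ⟨hW, hW', ?_, ?_, ?_⟩
    · -- `|S′ + S| = e^{-x}|(eˣS)′| ≤ e^{-x}/4 ≤ (5/14) S`
      have h1 : |deriv S x + S x| ≤ (Real.exp x)⁻¹ * (1 / 4) := by
        rw [le_inv_mul_iff₀ hex]; exact hd
      have h2 : (Real.exp x)⁻¹ ≤ 10 / 7 * S x := by
        rw [inv_le_iff_one_le_mul₀ hex]; nlinarith only [hlo]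
      calc |deriv S x + S x| ≤ (Real.exp x)⁻¹ * (1 / 4) := h1
        _ ≤ 10 / 7 * S x * (1 / 4) := by gcongr
        _ = 5 / 14 * S x := by ring
    · rw [hexinv, ← div_eq_mul_inv, div_le_iff₀ hex]; linarith only [hlo]
    · have e : S x = Real.exp (-x) * (Real.exp x * S x) := by
        rw [← mul_assoc, ← Real.exp_add, neg_add_cancel, Real.exp_zero, one_mul]
      rw [e]
      calc Real.exp (-x) * (Real.exp x * S x) ≤ Real.exp (-x) * 1 :=
            mul_le_mul_of_nonneg_left hhi (Real.exp_pos _).le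
        _ = Real.exp (-x) := mul_one _
  -- THE CONSTANT
  refine ⟨6 * r + 17 + BS, by linarith, ?_⟩
  intro Λ a N₁ N₂ u₁ u₂ f₁ f₂ hΛ hu₁ hE hB ha hN₁ hN₂ x
  obtain ⟨B, hB⟩ := hB
  have hS0 := hSpos 0
  have ha0 : 0 ≤ a := by
    have h1 : 0 ≤ |u₁ 0| / (1 + S 0) := by positivity
    have h2 : 0 ≤ |u₂ 0| / S 0 := by positivity
    linarith [ha 0]
  have hN₁0 : 0 ≤ N₁ := (abs_nonneg _).trans (hN₁ 0)
  have hN₂0 : 0 ≤ N₂ := by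
    have h1 : 0 ≤ |f₂ 0| / S 0 := by positivity
    linarith [hN₂ 0]
  have hΛ1 : 0 < Λ + 1 := by linarith
  obtain ⟨Q, hQ⟩ : ∃ Q : ℝ, Q = (Λ + 1) * a + N₂ + N₁ / (Λ + 1) := ⟨_, rfl⟩
  have hQ0 : 0 ≤ Q := by rw [hQ]; positivity
  have hQa : (Λ + 1) * a ≤ Q := by
    rw [hQ]
    have : 0 ≤ N₁ / (Λ + 1) := by positivity
    linarith
  rw [← hQ]
  -- pointwise consequences of the weighted bound
  have hu₂S : ∀ t, |u₂ t| ≤ a * S t := fun t => by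
    have hSt := hSpos t
    have h0 : 0 ≤ |u₁ t| / (1 + S t) := by positivity
    have h1 : |u₂ t| / S t ≤ a := by linarith [ha t]
    rwa [div_le_iff₀ hSt] at h1
  have hu₁S : ∀ t, |u₁ t| ≤ (1 + S t) * a := fun t => by
    have hSt := hSpos t
    have hS1 : 0 < 1 + S t := by linarith
    have h0 : 0 ≤ |u₂ t| / S t := by positivity
    have h1 : |u₁ t| / (1 + S t) ≤ a := by linarith [ha t]
    rw [div_le_iff₀ hS1] at h1
    linarith
  have hf₂S : ∀ t, |f₂ t| ≤ N₂ * S t := fun t => by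
    have h := hN₂ t
    rwa [div_le_iff₀ (hSpos t)] at h
  -- the splitting point `x_*`
  obtain ⟨X, hX⟩ : ∃ X : ℝ, X = 400 / 49 * (Λ + r + 2) := ⟨_, rfl⟩
  have hX1 : 1 < X := by rw [hX]; nlinarith only [hΛ, hr]
  have hX0 : 0 < X := by linarith
  obtain ⟨xs, hxs⟩ : ∃ xs : ℝ, xs = -(1 / 2) * Real.log X := ⟨_, rfl⟩
  have hxs0 : xs < 0 := by
    rw [hxs]; have := Real.log_pos hX1; linarith
  have hexs : Real.exp (-2 * xs) = X := by
    rw [hxs]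
    have : -2 * (-(1 / 2) * Real.log X) = Real.log X := by ring
    rw [this, Real.exp_log hX0]
  -- deep in the core: `S² ≥ 4(Λ + r + 2)` on `x ≤ x_*`
  have hdeep : ∀ t, t ≤ xs → 4 * (Λ + r + 2) ≤ S t ^ 2 := by
    intro t ht
    obtain ⟨-, -, -, hlo, -⟩ := henv t (by linarith)
    have h1 : X ≤ Real.exp (-2 * t) := by
      rw [← hexs]; exact Real.exp_le_exp.mpr (by linarith)
    have h2 : Real.exp (-2 * t) = Real.exp (-t) ^ 2 := by rw [← Real.exp_nat_mul]; ring_nf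
    have h3 : 49 / 100 * Real.exp (-t) ^ 2 ≤ S t ^ 2 := by
      have h0 : 0 ≤ 7 / 10 * Real.exp (-t) := by positivity
      nlinarith only [hlo, h0]
    rw [hX] at h1
    nlinarith only [h1, h2, h3]
  -- the pointwise package on `x ≤ x_*`
  have hpt : ∀ t, t ≤ xs →
      0 < S t ^ 2 - (W t - 1) ^ 2 ∧
      1 ≤ (3 * S t * (deriv S t + 2 * S t) + (W t - 1) * (Λ - deriv W t - 2 * W t + r)) /
        (S t ^ 2 - (W t - 1) ^ 2) ∧
      deriv u₁ t = -((3 * S t * (deriv S t + 2 * S t) + (W t - 1) * (Λ - deriv W t - 2 * W t + r)) /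
        (S t ^ 2 - (W t - 1) ^ 2)) * u₁ t +
        (3 * S t * (Λ * u₂ t - f₂ t - (deriv W t / 3 + 2 * W t - r) * u₂ t) +
          (W t - 1) * (f₁ t + (3 * deriv S t + 6 * S t) * u₂ t)) / (S t ^ 2 - (W t - 1) ^ 2) ∧
      |(3 * S t * (Λ * u₂ t - f₂ t - (deriv W t / 3 + 2 * W t - r) * u₂ t) +
          (W t - 1) * (f₁ t + (3 * deriv S t + 6 * S t) * u₂ t)) / (S t ^ 2 - (W t - 1) ^ 2)| ≤
        (6 * r + 16) * Q := by
    intro t ht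
    obtain ⟨hW, hW', hSS, -, -⟩ := henv t (by linarith)
    rw [hQ]
    exact centre_pointwise r (W t) (deriv W t) (S t) (deriv S t) Λ (u₁ t) (deriv u₁ t) (u₂ t) (deriv u₂ t)
      (f₁ t) (f₂ t) a N₁ N₂ hr hΛ (hSpos t) hW hW' hSS (hdeep t ht) (hE t).1 (hE t).2 (hu₂S t) (hN₁ t) (hf₂S t)
      ha0 hN₁0 hN₂0
  -- THE THREE REGIONS
  rcases le_or_gt x xs with hx | hx
  · -- deep core: damped transport from `−∞`
    set γ : ℝ → ℝ := fun t => (3 * S t * (deriv S t + 2 * S t) + (W t - 1) * (Λ - deriv W t - 2 * W t + r)) /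
      (S t ^ 2 - (W t - 1) ^ 2) with hγ
    set h : ℝ → ℝ := fun t => (3 * S t * (Λ * u₂ t - f₂ t - (deriv W t / 3 + 2 * W t - r) * u₂ t) +
      (W t - 1) * (f₁ t + (3 * deriv S t + 6 * S t) * u₂ t)) / (S t ^ 2 - (W t - 1) ^ 2) with hh
    have htrans : ∀ a₀, a₀ ≤ x → |u₁ x| ≤ |u₁ a₀| * Real.exp (-1 * (x - a₀)) + (6 * r + 16) * Q / 1 := by
      intro a₀ ha₀
      refine dampedTransport_apriori_bound γ h u₁ a₀ x 1 ((6 * r + 16) * Q) ha₀ one_pos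
        (fun t ht => (hpt t (ht.2.trans hx)).2.1) (fun t ht => (hpt t (ht.2.trans hx)).2.2.2)
        (fun t ht => ?_) x ⟨ha₀, le_rfl⟩
      have hd : HasDerivAt u₁ (deriv u₁ t) t := (hu₁ t).hasDerivAt
      rw [(hpt t (ht.2.trans hx)).2.2.1] at hd
      exact hd
    have hB1 : 0 < max B 1 := lt_max_of_lt_right one_pos
    have hbound : ∀ᶠ a₀ in atBot, |u₁ x| ≤ max B 1 * Real.exp (a₀ - x) + (6 * r + 16) * Q := by
      filter_upwards [eventually_le_atBot x] with a₀ ha₀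
      have h1 := htrans a₀ ha₀
      have h2 : |u₁ a₀| * Real.exp (-1 * (x - a₀)) ≤ max B 1 * Real.exp (a₀ - x) := by
        have e : Real.exp (-1 * (x - a₀)) = Real.exp (a₀ - x) := by ring_nf
        rw [e]
        exact mul_le_mul_of_nonneg_right ((hB a₀).trans (le_max_left _ _)) (Real.exp_pos _).le
      rw [div_one] at h1
      linarith
    have hlim : Tendsto (fun a₀ : ℝ => max B 1 * Real.exp (a₀ - x) + (6 * r + 16) * Q) atBot
        (𝓝 (max B 1 * 0 + (6 * r + 16) * Q)) := by
      have h1 : Tendsto (fun a₀ : ℝ => a₀ - x) atBot atBot := tendsto_atBot_add_const_right _ _ tendsto_id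
      exact ((Real.tendsto_exp_atBot.comp h1).const_mul _).add_const _
    have hle : |u₁ x| ≤ max B 1 * 0 + (6 * r + 16) * Q := ge_of_tendsto hlim hbound
    rw [mul_zero, zero_add] at hle
    calc |u₁ x| ≤ (6 * r + 16) * Q := hle
      _ ≤ (6 * r + 17 + BS) * Q := by nlinarith only [hQ0, hBS0]
  · rcases le_or_gt x 1 with hx1 | hx1
    · -- between `x_*` and `1`: `S ≤ e^{-x} ≤ e^{-x_*} ≤ (1 + X)/2`
      obtain ⟨-, -, -, -, hhi⟩ := henv x hx1
      have h1 : Real.exp (-x) ≤ Real.exp (-xs) := Real.exp_le_exp.mpr (by linarith)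
      have h2 : Real.exp (-xs) ≤ (1 + X) / 2 := by
        have e : Real.exp (-xs) ^ 2 = X := by rw [← hexs, ← Real.exp_nat_mul]; ring_nf
        nlinarith only [sq_nonneg (Real.exp (-xs) - 1), e]
      have hS : S x ≤ (1 + X) / 2 := hhi.trans (h1.trans h2)
      calc |u₁ x| ≤ (1 + S x) * a := hu₁S x
        _ ≤ (1 + (1 + X) / 2) * a := by gcongr
        _ ≤ (6 * r + 17 + BS) * ((Λ + 1) * a) := by
            rw [hX]
            have q1 : 0 ≤ Λ * a := by positivity
            have q2 : 0 ≤ r * (Λ * a) := by positivity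
            have q3 : 0 ≤ BS * (Λ * a) := by positivity
            have q4 : 0 ≤ r * a := by positivity
            have q5 : 0 ≤ BS * a := by positivity
            linarith only [q1, q2, q3, q4, q5, ha0]
        _ ≤ (6 * r + 17 + BS) * Q := mul_le_mul_of_nonneg_left hQa (by linarith)
    · -- far field: `S` bounded
      have hS : S x ≤ BS := (le_abs_self _).trans (hBS x hx1.le)
      calc |u₁ x| ≤ (1 + S x) * a := hu₁S x
        _ ≤ (1 + BS) * a := by gcongr
        _ ≤ (6 * r + 17 + BS) * ((Λ + 1) * a) := by
            have q1 : 0 ≤ Λ * a := by positivity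
            have q2 : 0 ≤ r * (Λ * a) := by positivity
            have q3 : 0 ≤ BS * (Λ * a) := by positivity
            have q4 : 0 ≤ r * a := by positivity
            linarith only [q1, q2, q3, q4, ha0]
        _ ≤ (6 * r + 17 + BS) * Q := mul_le_mul_of_nonneg_left hQa (by linarith)

end Summit.AtomisticToContinuum.HydrodynamicLimit.Theorems.PackingAnalyticImplosion

end
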